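import Summits.HubbardSuperconductivity.HubbardSuperconductivity.Theorems.ParityGapRigidityIncommensurateRigidityStructureFactor
import HarnessLib

/-!
# Route ParityGapRigidity — crux `IncommensurateRigidity` (stmt-HubbardSuperconductivity-2195):
# the refined bridge — `EtsTrichotomy` + (H1) + (H2) VERBATIM + no range-`≥ 2` density wave

Helper file (`--supports stmt-HubbardSuperconductivity-2195`, line `registered`, lead c9), sequel of
`…EtsBridge` (p167164) and `…StructureFactor` (p167919).

The density-wave operators of branch (B) of `AnomalyExhaustion.EtsTrichotomy` (stmt-1458),
`D_q(R, a) = Σ_x χ_q(x) Σ_{e ∈ R, σ, τ} a(e,σ,τ) c†_{xσ} c_{x+e,τ}`, are one-body operators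
`O_c = Σ_p c(p) c†_{p₁} c_{p₂}` with the coefficient function
`c(p) = Σ_{x, e ∈ R, σ, τ} [p = ((x,σ),(x+e,τ))] χ_q(x) a(e,σ,τ)` (`sum_coef_smul_eq_densityWave`),
which has momentum `q` (`coef_translate`), modulus `≤ Σ |a|` (`norm_coef_le`) and the range of `a`
(`torusDist_le_of_coef_ne_zero`). Hence the landed `structureFactor_le_of_normalFluctuations`
((H2) ⟹ bounded structure factors in every range-`≤ 1` channel) controls the part of `D_q(R, a)` with
`|e|_∞ ≤ 1`, and only the part with `|e|_∞ ≥ 2` needs a hypothesis of its own: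

* `yangODLRO_of_etsTrichotomy_of_normalFluctuations` — **the refined bridge** (registered sub-goal):
  `EtsTrichotomy` → `U > 0` → `δ ∈ (0,1/2)` irrational → (H1) verbatim → (H2) verbatim →
  [no density wave in ranges `|e|_∞ ≥ 2`: for coefficients `a` vanishing on the unit ball,
  `Re⟨D_q(R,a)† D_q(R,a)⟩_ψ = o(L⁴)` uniformly over sector ground states] → the crux's conclusion at
  `(U, δ)` verbatim. So, relative to the filed conjecture stmt-1458, the crux restricted to irrational
  `δ` costs exactly this residual clause; (H3), (H4) are idle.

No definitions (the coefficient function is written out); nothing vendored; folklore bookkeeping.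
-/

noncomputable section

namespace Summit.HubbardSuperconductivity.IncommensurateRigidity.Birth

open scoped BigOperators Matrix ComplexConjugate
open Matrix Filter Topology Literature.MathematicalPhysics.QuantumLattice Literature.Probability.LatticeModels

section Coefficient

variable {L : ℕ} [NeZero L]

/-- **The density-wave operator of `EtsTrichotomy` is the one-body operator of its coefficient
function**: `Σ_p c(p) c†_{p₁}c_{p₂} = Σ_x χ_q(x) Σ_{e∈R,σ,τ} a(e,σ,τ) c†_{xσ} c_{x+e,τ}` with
`c(p) = Σ_{x,e∈R,σ,τ} [p = ((x,σ),(x+e,τ))] χ_q(x) a(e,σ,τ)`. [folklore] -/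
theorem sum_coef_smul_eq_densityWave (R : Finset (Site 2)) (a : Site 2 → Fin 2 → Fin 2 → ℂ)
    (q : TorusSite 2 L) :
    ∑ p : Orb (FermionTorus 2 L) × Orb (FermionTorus 2 L),
        (∑ x : TorusSite 2 L, ∑ e ∈ R, ∑ σ : Fin 2, ∑ τ : Fin 2,
          if p = (orb (FermionTorus.ofTorusSite x) σ,
              orb (FermionTorus.ofTorusSite (x + Torus.proj L e)) τ)
          then torusChar q x * a e σ τ else 0) • (creation p.1 * annihilation p.2) =
      ∑ x : TorusSite 2 L, torusChar q x • ∑ e ∈ R, ∑ σ : Fin 2, ∑ τ : Fin 2,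
        a e σ τ • (creation (orb (FermionTorus.ofTorusSite x) σ) *
          annihilation (orb (FermionTorus.ofTorusSite (x + Torus.proj L e)) τ)) := by
  simp_rw [Finset.sum_smul]
  rw [Finset.sum_comm]
  refine Finset.sum_congr rfl fun x _ => ?_
  rw [Finset.sum_comm, Finset.smul_sum]
  refine Finset.sum_congr rfl fun e _ => ?_
  rw [Finset.sum_comm, Finset.smul_sum]
  refine Finset.sum_congr rfl fun σ _ => ?_
  rw [Finset.sum_comm, Finset.smul_sum]
  refine Finset.sum_congr rfl fun τ _ => ?_
  simp_rw [ite_smul, zero_smul, Finset.sum_ite_eq', Finset.mem_univ, if_true, smul_smul]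

/-- The `x`-sum in the coefficient function has at most one nonzero term: the site of `p₁`. [folklore] -/
theorem coef_eq_single (R : Finset (Site 2)) (a : Site 2 → Fin 2 → Fin 2 → ℂ) (q : TorusSite 2 L)
    (p : Orb (FermionTorus 2 L) × Orb (FermionTorus 2 L)) :
    (∑ x : TorusSite 2 L, ∑ e ∈ R, ∑ σ : Fin 2, ∑ τ : Fin 2,
        if p = (orb (FermionTorus.ofTorusSite x) σ,
            orb (FermionTorus.ofTorusSite (x + Torus.proj L e)) τ)
        then torusChar q x * a e σ τ else 0) =
      ∑ e ∈ R, ∑ σ : Fin 2, ∑ τ : Fin 2,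
        if p = (orb (FermionTorus.ofTorusSite (ofLex p.1).1.toTorusSite) σ,
            orb (FermionTorus.ofTorusSite ((ofLex p.1).1.toTorusSite + Torus.proj L e)) τ)
        then torusChar q (ofLex p.1).1.toTorusSite * a e σ τ else 0 := by
  refine Finset.sum_eq_single (ofLex p.1).1.toTorusSite (fun x _ hx => ?_) (fun h => absurd (Finset.mem_univ _) h)
  refine Finset.sum_eq_zero fun e _ => Finset.sum_eq_zero fun σ _ => Finset.sum_eq_zero fun τ _ => ?_
  rw [if_neg]
  rintro rfl
  exact hx (by simp)

/-- **The coefficient function is bounded by `Σ |a|`.** [folklore] -/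
theorem norm_coef_le (R : Finset (Site 2)) (a : Site 2 → Fin 2 → Fin 2 → ℂ) (q : TorusSite 2 L)
    (p : Orb (FermionTorus 2 L) × Orb (FermionTorus 2 L)) :
    ‖∑ x : TorusSite 2 L, ∑ e ∈ R, ∑ σ : Fin 2, ∑ τ : Fin 2,
        if p = (orb (FermionTorus.ofTorusSite x) σ,
            orb (FermionTorus.ofTorusSite (x + Torus.proj L e)) τ)
        then torusChar q x * a e σ τ else 0‖ ≤ ∑ e ∈ R, ∑ σ : Fin 2, ∑ τ : Fin 2, ‖a e σ τ‖ := by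
  rw [coef_eq_single]
  refine (norm_sum_le _ _).trans (Finset.sum_le_sum fun e _ => ?_)
  refine (norm_sum_le _ _).trans (Finset.sum_le_sum fun σ _ => ?_)
  refine (norm_sum_le _ _).trans (Finset.sum_le_sum fun τ _ => ?_)
  split_ifs
  · rw [norm_mul, norm_torusChar, one_mul]
  · rw [norm_zero]; exact norm_nonneg _

/-- **The coefficient function has the range of `a`**: if it is nonzero at `p`, then
`p = ((x,σ),(x+e,τ))` with `e ∈ R`, `a(e,σ,τ) ≠ 0`, so the torus distance of the two sites is
`‖π_L e‖`. [folklore] -/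
theorem torusDist_le_of_coef_ne_zero (R : Finset (Site 2)) (a : Site 2 → Fin 2 → Fin 2 → ℂ)
    (q : TorusSite 2 L) {r : ℕ} (hR : ∀ e ∈ R, ∀ σ τ, a e σ τ ≠ 0 → torusNorm (Torus.proj L e) ≤ r)
    (p : Orb (FermionTorus 2 L) × Orb (FermionTorus 2 L))
    (hp : (∑ x : TorusSite 2 L, ∑ e ∈ R, ∑ σ : Fin 2, ∑ τ : Fin 2,
        if p = (orb (FermionTorus.ofTorusSite x) σ,
            orb (FermionTorus.ofTorusSite (x + Torus.proj L e)) τ)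
        then torusChar q x * a e σ τ else 0) ≠ 0) :
    torusDist (ofLex p.1).1.toTorusSite (ofLex p.2).1.toTorusSite ≤ r := by
  obtain ⟨x, -, h1⟩ := Finset.exists_ne_zero_of_sum_ne_zero hp
  obtain ⟨e, he, h2⟩ := Finset.exists_ne_zero_of_sum_ne_zero h1
  obtain ⟨σ, -, h3⟩ := Finset.exists_ne_zero_of_sum_ne_zero h2
  obtain ⟨τ, -, h4⟩ := Finset.exists_ne_zero_of_sum_ne_zero h3
  split_ifs at h4 with hpe
  · have ha : a e σ τ ≠ 0 := fun h => h4 (by rw [h, mul_zero])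
    have := hR e he σ τ ha
    rw [hpe]
    change torusDist (FermionTorus.toTorusSite (FermionTorus.ofTorusSite x))
      (FermionTorus.toTorusSite (FermionTorus.ofTorusSite (x + Torus.proj L e))) ≤ r
    rw [FermionTorus.toTorusSite_ofTorusSite, FermionTorus.toTorusSite_ofTorusSite, torusDist_comm']
    change torusNorm (x + Torus.proj L e - x) ≤ r
    rwa [add_sub_cancel_left]
  · exact absurd rfl h4

/-- Pairs of images under a permutation: `(π p₁, π p₂) = (x, y) ↔ p = (π⁻¹ x, π⁻¹ y)`. [folklore] -/
theorem perm_prod_eq_iff {α : Type*} (π : Equiv.Perm α) (p : α × α) (x y : α) :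
    (π p.1, π p.2) = (x, y) ↔ p = (π.symm x, π.symm y) := by
  obtain ⟨p₁, p₂⟩ := p
  simp only [Prod.mk.injEq, Equiv.apply_eq_iff_eq_symm_apply]

/-- The inverse translation on orbitals: `T_v⁻¹ (x, σ) = (x - v, σ)`. [folklore] -/
theorem translate_symm_orb (v x : TorusSite 2 L) (σ : Fin 2) :
    (Orb.translate v).symm (orb (FermionTorus.ofTorusSite x) σ) =
      orb (FermionTorus.ofTorusSite (x + -v)) σ := by
  rw [← Equiv.Perm.inv_def, ← Orb.translate_neg, Orb.translate_orb]

/-- **The coefficient function has momentum `q`**: `c(T_v p₁, T_v p₂) = χ_q(v) c(p)`. [folklore] -/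
theorem coef_translate (R : Finset (Site 2)) (a : Site 2 → Fin 2 → Fin 2 → ℂ) (q v : TorusSite 2 L)
    (p : Orb (FermionTorus 2 L) × Orb (FermionTorus 2 L)) :
    (∑ x : TorusSite 2 L, ∑ e ∈ R, ∑ σ : Fin 2, ∑ τ : Fin 2,
        if (Orb.translate v p.1, Orb.translate v p.2) = (orb (FermionTorus.ofTorusSite x) σ,
            orb (FermionTorus.ofTorusSite (x + Torus.proj L e)) τ)
        then torusChar q x * a e σ τ else 0) =
      torusChar q v * ∑ x : TorusSite 2 L, ∑ e ∈ R, ∑ σ : Fin 2, ∑ τ : Fin 2,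
        if p = (orb (FermionTorus.ofTorusSite x) σ,
            orb (FermionTorus.ofTorusSite (x + Torus.proj L e)) τ)
        then torusChar q x * a e σ τ else 0 := by
  simp_rw [perm_prod_eq_iff, translate_symm_orb, add_right_comm _ (Torus.proj L _) (-v)]
  rw [← Equiv.sum_comp (Equiv.addRight v)]
  simp only [Equiv.coe_addRight, add_neg_cancel_right, torusChar_add_right]
  rw [Finset.mul_sum]
  refine Finset.sum_congr rfl fun x _ => ?_
  rw [Finset.mul_sum]
  refine Finset.sum_congr rfl fun e _ => ?_
  rw [Finset.mul_sum]
  refine Finset.sum_congr rfl fun σ _ => ?_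
  rw [Finset.mul_sum]
  refine Finset.sum_congr rfl fun τ _ => ?_
  split_ifs
  · ring
  · rw [mul_zero]

/-- The density-wave operator is additive in the coefficients `a`. [folklore] -/
theorem densityWave_add (R : Finset (Site 2)) (a₁ a₂ : Site 2 → Fin 2 → Fin 2 → ℂ)
    (q : TorusSite 2 L) :
    (∑ x : TorusSite 2 L, torusChar q x • ∑ e ∈ R, ∑ σ : Fin 2, ∑ τ : Fin 2,
        (a₁ e σ τ + a₂ e σ τ) • (creation (orb (FermionTorus.ofTorusSite x) σ) *
          annihilation (orb (FermionTorus.ofTorusSite (x + Torus.proj L e)) τ))) =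
      (∑ x : TorusSite 2 L, torusChar q x • ∑ e ∈ R, ∑ σ : Fin 2, ∑ τ : Fin 2,
        a₁ e σ τ • (creation (orb (FermionTorus.ofTorusSite x) σ) *
          annihilation (orb (FermionTorus.ofTorusSite (x + Torus.proj L e)) τ))) +
      ∑ x : TorusSite 2 L, torusChar q x • ∑ e ∈ R, ∑ σ : Fin 2, ∑ τ : Fin 2,
        a₂ e σ τ • (creation (orb (FermionTorus.ofTorusSite x) σ) *
          annihilation (orb (FermionTorus.ofTorusSite (x + Torus.proj L e)) τ)) := by
  simp only [add_smul, Finset.sum_add_distrib, smul_add]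

/-- Steps of the unit ball of `ℤ²` project to torus vectors of periodic norm `≤ 1`. [folklore] -/
theorem torusNorm_proj_le_one {e : Site 2} (he : ∀ i, |e i| ≤ 1) : torusNorm (Torus.proj L e) ≤ 1 := by
  refine Finset.sup_le fun i _ => ?_
  rw [← ZMod.valMinAbs_natAbs_eq_min, Torus.proj_apply]
  have h1 : ((e i : ℤ) : ZMod L).valMinAbs.natAbs ≤ (e i).natAbs :=
    ZMod.natAbs_min_of_le_div_two L _ _ (by rw [ZMod.coe_valMinAbs]) (ZMod.natAbs_valMinAbs_le _)
  have h2 : (e i).natAbs ≤ 1 := by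
    have := he i
    rw [Int.abs_eq_natAbs] at this
    exact_mod_cast this
  exact h1.trans h2

end Coefficient

/-- **Parallelogram bound** `Re⟨u + w, u + w⟩ ≤ 2 Re⟨u, u⟩ + 2 Re⟨w, w⟩` in `ℓ²`. [folklore] -/
theorem re_star_add_dotProduct_add_le {n : Type*} [Fintype n] (u w : n → ℂ) :
    (star (u + w) ⬝ᵥ (u + w)).re ≤ 2 * (star u ⬝ᵥ u).re + 2 * (star w ⬝ᵥ w).re := by
  have hid : star (u + w) ⬝ᵥ (u + w) + star (u - w) ⬝ᵥ (u - w) =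
      2 * (star u ⬝ᵥ u) + 2 * (star w ⬝ᵥ w) := by
    simp only [star_add, star_sub, add_dotProduct, sub_dotProduct, dotProduct_add, dotProduct_sub]
    ring
  have hre := congrArg Complex.re hid
  simp only [Complex.add_re, Complex.mul_re, Complex.re_ofNat, Complex.im_ofNat, zero_mul,
    sub_zero] at hre
  have hnn : 0 ≤ (star (u - w) ⬝ᵥ (u - w)).re := by
    rw [star_dotProduct_self_re]; positivity
  linarith

/-! ### The refined bridge -/

/-- **Refined bridge: `EtsTrichotomy` + (H1) + (H2) verbatim + no range-`≥ 2` density wave ⟹ the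
crux's conclusion at `(U, δ)`, `δ` irrational.** Hypotheses: the trichotomy (stmt-1458, a
HYPOTHESIS); `U > 0`, `δ ∈ (0, 1/2)` irrational; the crux's (H1) and (H2) verbatim; and the residual
clause — for every finite `R ⊂ ℤ²`, coefficients `a` VANISHING ON THE UNIT BALL (`a(e,σ,τ) ≠ 0 ⟹
|e_i| > 1` for some `i`) and `c > 0`, eventually in even `L`, `Re⟨D_q(R,a)† D_q(R,a)⟩_ψ ≤ c·L⁴` for all
`q ≠ 0` and all normalised sector ground states `ψ`. Proof: split a general coefficient `a` of branch
(B) into its unit-ball part `a₁` and the rest `a₂`; `D(a) = D(a₁) + D(a₂)`; the landed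
`structureFactor_le_of_normalFluctuations` bounds `‖D(a₁)ψ‖² ≤ C L² A²` through the coefficient
function of `D(a₁)` (momentum `q`, modulus `≤ A`, range `≤ 1`), the residual clause bounds
`‖D(a₂)ψ‖² ≤ (c/4) L⁴`, and `‖u + w‖² ≤ 2‖u‖² + 2‖w‖²`; then `yangODLRO_of_etsTrichotomy`. [folklore] -/
theorem yangODLRO_of_etsTrichotomy_of_normalFluctuations :
    Summit.HubbardSuperconductivity.HubbardSuperconductivity.Theses.AnomalyExhaustion.EtsTrichotomy →
    ∀ (U δ : ℝ), 0 < U → δ ∈ Set.Ioo (0 : ℝ) (1 / 2) → Irrational δ →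
    (∃ C m : ℝ, 0 < m ∧ ∃ L₀ : ℕ, ∀ L ≥ L₀, Even L → ∀ Hm, Hm = hubbardTorus 2 L 1 U → ∀ ψ,
      IsGroundStateInSector Hm (2 * ⌊(1 - δ) * (L : ℝ) ^ 2 / 2⌋₊) 0 ψ → star ψ ⬝ᵥ ψ = 1 →
      ∀ (x y : FermionTorus 2 L) (σ τ : Fin 2),
        ‖oneParticleRDM ψ (orb x σ) (orb y τ)‖ ≤
          C * Real.exp (-(m * (torusDist x.toTorusSite y.toTorusSite : ℝ)))) →
    (∃ C : ℝ, ∃ L₀ : ℕ, ∀ L ≥ L₀, Even L → ∀ Hm, Hm = hubbardTorus 2 L 1 U → ∀ ψ,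
      IsGroundStateInSector Hm (2 * ⌊(1 - δ) * (L : ℝ) ^ 2 / 2⌋₊) 0 ψ → star ψ ⬝ᵥ ψ = 1 →
      ∀ a : Orb (FermionTorus 2 L) × Orb (FermionTorus 2 L) → ℂ, (∀ p, ‖a p‖ ≤ 1) →
        (∀ p, a p ≠ 0 → torusDist (ofLex p.1).1.toTorusSite (ofLex p.2).1.toTorusSite ≤ 1) →
        (expect (Matrix.conjTranspose (∑ p, a p • (creation p.1 * annihilation p.2)) *
            (∑ p, a p • (creation p.1 * annihilation p.2))) ψ).re -
          ‖expect (∑ p, a p • (creation p.1 * annihilation p.2)) ψ‖ ^ 2 ≤ C * (L : ℝ) ^ 2) →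
    (∀ (R : Finset (Site 2)) (a : Site 2 → Fin 2 → Fin 2 → ℂ) (c : ℝ), 0 < c →
      (∀ e σ τ, a e σ τ ≠ 0 → ∃ i, 1 < |e i|) →
      ∃ L₀ : ℕ, ∀ (L : ℕ) [NeZero L], L₀ ≤ L → Even L → ∀ ψ,
        IsGroundStateInSector (hubbardTorus 2 L 1 U) (2 * ⌊(1 - δ) * (L : ℝ) ^ 2 / 2⌋₊) 0 ψ →
        star ψ ⬝ᵥ ψ = 1 → ∀ q : TorusSite 2 L, q ≠ 0 →
          (expect ((∑ x : TorusSite 2 L, torusChar q x • ∑ e ∈ R, ∑ σ : Fin 2, ∑ τ : Fin 2,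
              a e σ τ • (creation (orb (FermionTorus.ofTorusSite x) σ) *
                annihilation (orb (FermionTorus.ofTorusSite (x + Torus.proj L e)) τ)))ᴴ *
            (∑ x : TorusSite 2 L, torusChar q x • ∑ e ∈ R, ∑ σ : Fin 2, ∑ τ : Fin 2,
              a e σ τ • (creation (orb (FermionTorus.ofTorusSite x) σ) *
                annihilation (orb (FermionTorus.ofTorusSite (x + Torus.proj L e)) τ)))) ψ).re ≤
            c * (L : ℝ) ^ 4) →
    ∃ a : ℝ, 0 < a ∧ ∃ L₁ : ℕ, ∀ L ≥ L₁, Even L → ∀ Hm, Hm = hubbardTorus 2 L 1 U → ∀ ψ,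
      IsGroundStateInSector Hm (2 * ⌊(1 - δ) * (L : ℝ) ^ 2 / 2⌋₊) 0 ψ → star ψ ⬝ᵥ ψ = 1 →
      ∃ v : Orb (FermionTorus 2 L) × Orb (FermionTorus 2 L) → ℂ,
        star v ⬝ᵥ v = 1 ∧ a * (L : ℝ) ^ 2 ≤ (star v ⬝ᵥ Matrix.mulVec (twoParticleRDM ψ) v).re := by
  intro hE U δ hU hδ hirr h1 h2 hres
  refine yangODLRO_of_etsTrichotomy hE U δ hU hδ hirr h1 fun R a c hc => ?_
  -- split the coefficients by range: unit ball / the rest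
  set a₁ : Site 2 → Fin 2 → Fin 2 → ℂ := fun e σ τ => if ∀ i, |e i| ≤ 1 then a e σ τ else 0
    with ha₁def
  set a₂ : Site 2 → Fin 2 → Fin 2 → ℂ := fun e σ τ => if ∀ i, |e i| ≤ 1 then 0 else a e σ τ
    with ha₂def
  have hfun : a = fun e σ τ => a₁ e σ τ + a₂ e σ τ := by
    funext e σ τ
    simp only [ha₁def, ha₂def]
    split_ifs <;> simp
  have ha₁ : ∀ e σ τ, a₁ e σ τ ≠ 0 → ∀ i, |e i| ≤ 1 := by
    intro e σ τ h
    simp only [ha₁def] at h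
    split_ifs at h with hh
    · exact hh
    · exact absurd rfl h
  have ha₂ : ∀ e σ τ, a₂ e σ τ ≠ 0 → ∃ i, 1 < |e i| := by
    intro e σ τ h
    simp only [ha₂def] at h
    split_ifs at h with hh
    · exact absurd rfl h
    · obtain ⟨i, hi⟩ := not_forall.1 hh
      exact ⟨i, not_le.1 hi⟩
  obtain ⟨C, L₂, hSF⟩ := structureFactor_le_of_normalFluctuations U δ h2
  obtain ⟨L₃, hL₃⟩ := hres R a₂ (c / 4) (by positivity) ha₂
  set A : ℝ := ∑ e ∈ R, ∑ σ : Fin 2, ∑ τ : Fin 2, ‖a₁ e σ τ‖ + 1 with hAdef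
  have hA : 0 < A := by positivity
  set C' : ℝ := max C 0 with hC'
  obtain ⟨L₄, hL₄⟩ := exists_nat_ge (4 * C' * A ^ 2 / c)
  refine ⟨max (max L₂ L₃) (max L₄ 1), fun L _ hL hev ψ hgs hn q hq => ?_⟩
  have hL2 : L₂ ≤ L := le_trans (le_max_left _ _) (le_trans (le_max_left _ _) hL)
  have hL3 : L₃ ≤ L := le_trans (le_max_right _ _) (le_trans (le_max_left _ _) hL)
  have hL4 : (L₄ : ℝ) ≤ L := by exact_mod_cast le_trans (le_max_left _ _) (le_trans (le_max_right _ _) hL)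
  have hL1 : (1 : ℝ) ≤ L := by exact_mod_cast le_trans (le_max_right _ _) (le_trans (le_max_right _ _) hL)
  -- piece 1: the unit-ball part, through its coefficient function and (H2)
  have hpiece1 := hSF L hL2 hev ψ hgs hn _ A hA
    (fun p => (norm_coef_le R a₁ q p).trans (le_add_of_nonneg_right zero_le_one))
    (fun p hp => torusDist_le_of_coef_ne_zero R a₁ q
      (fun e _ σ τ h => torusNorm_proj_le_one (ha₁ e σ τ h)) p hp)
    q hq (fun v p => coef_translate R a₁ q v p)
  rw [sum_coef_smul_eq_densityWave, expect_conjTranspose_mul_self_eq] at hpiece1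
  -- piece 2: the residual part
  have hpiece2 := hL₃ L hL3 hev ψ hgs hn q hq
  rw [expect_conjTranspose_mul_self_eq] at hpiece2
  -- thresholds
  have hkey : C' * (L : ℝ) ^ 2 * A ^ 2 ≤ c / 4 * (L : ℝ) ^ 4 := by
    have h1 : 4 * C' * A ^ 2 / c ≤ L := hL₄.trans hL4
    rw [div_le_iff₀ hc] at h1
    have hLL : (L : ℝ) ≤ (L : ℝ) ^ 2 := by
      rw [sq]
      exact le_mul_of_one_le_right (by linarith) hL1
    have h2 : 4 * C' * A ^ 2 ≤ c * (L : ℝ) ^ 2 :=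
      h1.trans (by rw [mul_comm]; exact mul_le_mul_of_nonneg_left hLL hc.le)
    have h3 : 4 * C' * A ^ 2 * (L : ℝ) ^ 2 ≤ c * (L : ℝ) ^ 2 * (L : ℝ) ^ 2 :=
      mul_le_mul_of_nonneg_right h2 (sq_nonneg _)
    nlinarith [h3]
  have hC'C : C * (L : ℝ) ^ 2 * A ^ 2 ≤ C' * (L : ℝ) ^ 2 * A ^ 2 := by
    gcongr
    exact le_max_left _ _
  -- combine
  rw [hfun]
  beta_reduce
  rw [densityWave_add, expect_conjTranspose_mul_self_eq, add_mulVec]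
  refine (re_star_add_dotProduct_add_le _ _).trans ?_
  linarith

end Summit.HubbardSuperconductivity.IncommensurateRigidity.Birth

end
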